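import Summits.ResolutionOfSingularities.ResolutionOfSingularities.Theorems.PurelyInseparableDim4InScopeWinCert
import Summits.ResolutionOfSingularities.ResolutionOfSingularities.Theorems.PurelyInseparableDim4ScopeBlindRationalNorm
import Summits.ResolutionOfSingularities.ResolutionOfSingularities.Theorems.PurelyInseparableDim4ScopeBlindBatch1
import HarnessLib
import HarnessLib.Audit.Tags

/-!
# Purely inseparable fourfolds — IN-SCOPE WIN CERTIFICATES WITH EXTERNAL LEAVES
# [OURS · counted 0 · a certificate format for OUR frame v4, not about resolution]

Census cell «res-dim4-pi» (D-0157 DOOR 2), width seat `res-dim4-p-14` (generation 2), sequel of PR-12u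
`PurelyInseparableDim4InScopeWinCert` (`ICert`, `iwinCertB`, `inScopeStateWins_of_iwinCertB`).  Desk WORD #37 (c) /
#38 (a) put the F4-C instrument's positive half into the kernel as batches of `ICert (ZMod 2)` literals
(res-rescue-typ-3 g7's `…InScopeWinCertBatchW1…`, res-dim4-p-13's `…BandWin…`); two format requests came back
(typ-3g7 18:46:20Z: a `.ratn` blindness constructor dispatching to p-13's NORMALISED rational check `rblindBn`;
18:32:35Z: children shared between certificates / translated roots).  Both are served here WITHOUT touching the
landed inductive `BlindCert` (append-only rule), by one new checker:

* `iwinCertBL q L T` — `iwinCertB` whose child look-up (`ichildIn`) ALSO accepts a list `L : List (SData 4 K)` of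
  LEAF STATES whose in-scope escapability is proved ELSEWHERE (a blind state of any of p-13's `ScopeBlindBatch…` /
  `ScopeBlindRational(Norm)` files, a row state of an already-checked certificate of an earlier batch, …); the row
  check is PR-12u's `irowOK` verbatim, run against `rest ++ leafRows L`;
* **`inScopeStateWins_of_iwinCertBL`** — soundness: `(∀ s ∈ L, InScopeStateWins q s.toState) →
  iwinCertBL q L T = true → ∀ row ∈ T, InScopeStateWins q row.1.toState`; batch form
  `inScopeStateWins_of_all_iwinCertBL`; `iwinCertBL_nil` (`L = []` is `iwinCertB`) and `iwinCertBL_of_iwinCertB`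
  (every PR-12u certificate passes with any `L`);
* LEAF SUPPLY (one-liners): `leaves_of_not_inCoordinateScope` (any row grammar `ρ` with a state projection and a
  theorem `∀ r ∈ rows, ¬ InCoordinateScope q (π r).toState.F` — p-13's `not_inCoordinateScope_of_mem_blindRows…`,
  `…_of_mem_rblindRows…`, `…_of_mem_run4bRows` — yields `∀ s ∈ rows.map π, InScopeStateWins q s.toState`),
  `leaves_of_certs` (all row states of a checked batch `Ts` are leaves: `certStates Ts`), `leaves_append`;
* ACCEPTANCE over `𝔽₂` by `decide`: PR-12u's SCOPE-LOSS root `x₁³x₂ + x₁³x₃x₄` as a ONE-ROW certificate whose four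
  blind children are cited as leaves from the landed `scopeLossCert` (`iwinCertBL_scopeLossRoot`,
  `inScopeStateWins_scopeLossRoot'`), and leaf lists drawn from p-13's normalised-rational rows `run4bRows`
  (`leaves_run4bRows`, the `.ratn` path) and monomial rows `blindRowsA` (`leaves_blindRowsA`).

COST NOTE for emitters: `ichildIn` scans `rest ++ leafRows L` once per equimultiple reply, so keep `L` per
certificate (or per file) to the leaves actually cited.  CAVEAT as in PR-12u: `K`-rational replies over a finite
`K` only; nothing ascends from `𝔽₂` to `𝔽₄`.  Nothing here proves resolution of singularities in dimension ≥ 4 /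
characteristic `p`; counted 0; AI work, weaker than expert review.
bears_on: LADDER-RESOLUTION:D157-DOOR2 (res-dim4-pi · PR-12u sequel · F4-C instrument kernel half). Supports
stmt-ResolutionOfSingularities-16155 (helper).
-/

set_option linter.dupNamespace false

noncomputable section

namespace Summit.ResolutionOfSingularities.ResolutionOfSingularities.Theorems.PIDim4

namespace InScopeWinCert

open Literature.AlgebraicGeometry.Resolution
open StepKit WinCertSound ScopeBlind

variable {K : Type} [Field K] [DecidableEq K]

/-! ## 1. The checker with external leaves -/

/-- Leaf states dressed as certificate rows (centre and blindness slot unused). [folklore] -/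
def leafRows (L : List (SData 4 K)) : ICert K := L.map fun s => (s, ∅, none)

omit [Field K] [DecidableEq K] in
/-- Membership in `leafRows`. [folklore] -/
theorem mem_leafRows {L : List (SData 4 K)} {r : IRow K} (h : r ∈ leafRows L) : ∃ s ∈ L, r = (s, ∅, none) := by
  obtain ⟨s, hs, rfl⟩ := List.mem_map.mp h
  exact ⟨s, hs, rfl⟩

variable [Fintype K]

/-- **In-scope win-certificate checker with external leaves**: PR-12u's row check `irowOK`, the children of a
row being looked up among the LATER rows AND among the leaf states `L`. [folklore] -/
def iwinCertBL (q : ℕ) (L : List (SData 4 K)) : ICert K → Bool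
  | [] => true
  | row :: rest => irowOK q (rest ++ leafRows L) row && iwinCertBL q L rest

/-- **SOUNDNESS OF IN-SCOPE WIN CERTIFICATES WITH EXTERNAL LEAVES**: if every leaf state is in-scope escapable,
every row state of a checked certificate is in-scope escapable over the finite field `K`. [folklore] -/
theorem inScopeStateWins_of_iwinCertBL {q : ℕ} {L : List (SData 4 K)}
    (hL : ∀ s ∈ L, InScopeStateWins q s.toState) :
    ∀ {T : ICert K}, iwinCertBL q L T = true → ∀ row ∈ T, InScopeStateWins q row.1.toState
  | [], _ => fun row hrow => absurd hrow List.not_mem_nil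
  | row :: rest, h => by
    unfold iwinCertBL at h
    rw [Bool.and_eq_true] at h
    have hrest := inScopeStateWins_of_iwinCertBL hL h.2
    have hrestL : ∀ r ∈ rest ++ leafRows L, InScopeStateWins q r.1.toState := by
      intro r hr
      rcases List.mem_append.mp hr with h1 | h2
      · exact hrest r h1
      · obtain ⟨s, hs, rfl⟩ := mem_leafRows h2
        exact hL s hs
    intro r hr
    rcases List.mem_cons.mp hr with rfl | hr'
    · exact inScopeStateWins_of_irowOK hrestL h.1
    · exact hrest r hr'

/-- The ROOT of a checked certificate with leaves is in-scope escapable. [folklore] -/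
theorem inScopeStateWins_head_of_iwinCertBL {q : ℕ} {L : List (SData 4 K)}
    (hL : ∀ s ∈ L, InScopeStateWins q s.toState) {row : IRow K} {rest : ICert K}
    (h : iwinCertBL q L (row :: rest) = true) : InScopeStateWins q row.1.toState :=
  inScopeStateWins_of_iwinCertBL hL h row List.mem_cons_self

/-- **Batch form**: a list of certificates all checked against the same leaf list. [folklore] -/
theorem inScopeStateWins_of_all_iwinCertBL {q : ℕ} {L : List (SData 4 K)}
    (hL : ∀ s ∈ L, InScopeStateWins q s.toState) {Ts : List (ICert K)}
    (h : Ts.all (iwinCertBL q L) = true) : ∀ T ∈ Ts, ∀ row ∈ T, InScopeStateWins q row.1.toState :=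
  fun T hT => inScopeStateWins_of_iwinCertBL hL (List.all_eq_true.mp h T hT)

/-! ## 2. Compatibility with PR-12u's `iwinCertB` -/

omit [Fintype K] in
/-- `ichildIn` is monotone under appending rows. [folklore] -/
theorem ichildIn_append_of_ichildIn [Fintype K] {rest extra : ICert K} {c : SData 4 K}
    (h : ichildIn rest c = true) : ichildIn (rest ++ extra) c = true := by
  unfold ichildIn at h ⊢
  rw [List.any_append, h, Bool.true_or]

/-- `irowOK` is monotone under appending rows to `rest`. [folklore] -/
theorem irowOK_append_of_irowOK {q : ℕ} {rest extra : ICert K} {row : IRow K}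
    (h : irowOK q rest row = true) : irowOK q (rest ++ extra) row = true := by
  unfold irowOK at h ⊢
  rw [Bool.or_eq_true, Bool.or_eq_true] at h ⊢
  rcases h with h12 | h3
  · exact Or.inl h12
  · refine Or.inr ?_
    rw [Bool.and_eq_true, decide_eq_true_eq] at h3 ⊢
    refine ⟨h3.1, fun j hj b hb => ?_⟩
    have h' := h3.2 j hj b hb
    unfold ireplyOK at h' ⊢
    rw [Bool.or_eq_true, Bool.or_eq_true] at h' ⊢
    rcases h' with h12 | hc
    · exact Or.inl h12
    · exact Or.inr (ichildIn_append_of_ichildIn hc)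

/-- **Every PR-12u certificate passes the leaf checker**, with any leaf list. [folklore] -/
theorem iwinCertBL_of_iwinCertB {q : ℕ} (L : List (SData 4 K)) :
    ∀ {T : ICert K}, iwinCertB q T = true → iwinCertBL q L T = true
  | [], _ => rfl
  | row :: rest, h => by
    unfold iwinCertB at h
    unfold iwinCertBL
    rw [Bool.and_eq_true] at h ⊢
    exact ⟨irowOK_append_of_irowOK h.1, iwinCertBL_of_iwinCertB L h.2⟩

/-- With no leaves the new checker IS `iwinCertB`. [folklore] -/
theorem iwinCertBL_nil {q : ℕ} : ∀ T : ICert K, iwinCertBL q ([] : List (SData 4 K)) T = iwinCertB q T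
  | [] => rfl
  | row :: rest => by
    unfold iwinCertBL iwinCertB
    rw [iwinCertBL_nil rest]
    simp only [leafRows, List.map_nil, List.append_nil]

/-! ## 3. Leaf supply -/

omit [DecidableEq K] [Fintype K] in
/-- **Blind states are leaves**: any row grammar `ρ` with a state projection `π` and a blindness theorem for its
rows (p-13's `not_inCoordinateScope_of_mem_blindRows…` / `…rblindRows…` / `…run4bRows`) supplies leaves.
[folklore] -/
theorem leaves_of_not_inCoordinateScope [DecidableEq K] {q : ℕ} {ρ : Type} (π : ρ → SData 4 K) {rows : List ρ}
    (h : ∀ r ∈ rows, ¬ InCoordinateScope q (π r).toState.F) :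
    ∀ s ∈ rows.map π, InScopeStateWins q s.toState := by
  intro s hs
  obtain ⟨r, hr, rfl⟩ := List.mem_map.mp hs
  exact inScopeStateWins_of_not_inCoordinateScope (h r hr)

/-- The row states of a list of certificates. [folklore] -/
def certStates (Ts : List (ICert K)) : List (SData 4 K) := (Ts.flatMap id).map fun r => r.1

omit [DecidableEq K] [Fintype K] in
/-- **Row states of checked certificates are leaves** (chaining batches: cite, do not repeat, a sub-DAG).
[folklore] -/
theorem leaves_of_certs [DecidableEq K] {q : ℕ} {Ts : List (ICert K)}
    (h : ∀ T ∈ Ts, ∀ row ∈ T, InScopeStateWins q row.1.toState) :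
    ∀ s ∈ certStates Ts, InScopeStateWins q s.toState := by
  intro s hs
  obtain ⟨r, hr, rfl⟩ := List.mem_map.mp hs
  obtain ⟨T, hT, hrT⟩ := List.mem_flatMap.mp hr
  exact h T hT r hrT

omit [DecidableEq K] [Fintype K] in
/-- Concatenating leaf lists. [folklore] -/
theorem leaves_append [DecidableEq K] {q : ℕ} {L₁ L₂ : List (SData 4 K)}
    (h₁ : ∀ s ∈ L₁, InScopeStateWins q s.toState) (h₂ : ∀ s ∈ L₂, InScopeStateWins q s.toState) :
    ∀ s ∈ L₁ ++ L₂, InScopeStateWins q s.toState := by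
  intro s hs
  rcases List.mem_append.mp hs with h | h
  · exact h₁ s h
  · exact h₂ s h

/-- p-13's monomial-curve rows (`ScopeBlind.BlindRow`, `q = 2` over `𝔽₂`): a passing row's state is a leaf.
[folklore] -/
theorem inScopeStateWins_of_rowBlindB {r : BlindRow} (h : rowBlindB r = true) :
    InScopeStateWins 2 r.1.toState :=
  inScopeStateWins_of_not_inCoordinateScope (not_inCoordinateScope_of_blindB h)

/-- p-13's NORMALISED rational-curve rows (`ScopeBlind.RBlindRow`, checked by `rblindBn`; typ-3g7's `.ratn`
request): a passing row's state is a leaf. [folklore] -/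
theorem inScopeStateWins_of_rowRBlindB {r : RBlindRow} (h : rowRBlindB r = true) :
    InScopeStateWins 2 r.1.toState :=
  inScopeStateWins_of_not_inCoordinateScope (not_inCoordinateScope_of_rowRBlindB h)

/-- The 22 states of eng-w5 RUN 4b's scope-game traps (p-13's `run4bRows`, normalised rational certificates) as
a leaf list. [folklore] -/
theorem leaves_run4bRows :
    ∀ s ∈ run4bRows.map (fun r : RBlindRow => r.1), InScopeStateWins 2 s.toState :=
  leaves_of_not_inCoordinateScope (fun r : RBlindRow => r.1) not_inCoordinateScope_of_mem_run4bRows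

/-- Batch A of p-13's `ScopeBlindBatch1` (134 monomial-curve rows) as a leaf list. [folklore] -/
theorem leaves_blindRowsA :
    ∀ s ∈ blindRowsA.map (fun r : BlindRow => r.1), InScopeStateWins 2 s.toState :=
  leaves_of_not_inCoordinateScope (fun r : BlindRow => r.1) not_inCoordinateScope_of_mem_blindRowsA

/-! ## 4. Acceptance over `𝔽₂`: the SCOPE-LOSS root with its blind children CITED as leaves -/

/-- The four blind children of PR-12u's scope-loss root (rows 2–5 of the landed `scopeLossCert`), as leaf
states. [folklore] -/
def scopeLossLeaves : List (SData 4 (ZMod 2)) := (scopeLossCert.drop 1).map fun r => r.1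

/-- The leaves are in-scope escapable — CITED from the landed certificate, not re-certified. [folklore] -/
theorem leaves_scopeLoss : ∀ s ∈ scopeLossLeaves, InScopeStateWins 2 s.toState := by
  intro s hs
  obtain ⟨r, hr, rfl⟩ := List.mem_map.mp hs
  exact inScopeStateWins_of_iwinCertB iwinCertB_scopeLoss r (List.mem_of_mem_drop hr)

/-- The scope-loss ROOT alone, A's centre the forced divisor `{x₁}`; its equimultiple replies are discharged by
the leaf list. [folklore] -/
def scopeLossRootCert : ICert (ZMod 2) :=
  [(⟨[(![3, 1, 0, 0], 1), (![3, 0, 1, 1], 1)], ![0, 0, 0, 0], ∅⟩, {0}, none)]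

/-- The one-row certificate checks against the cited leaves (`q = 2`, over `𝔽₂`). [folklore] -/
theorem iwinCertBL_scopeLossRoot : iwinCertBL 2 scopeLossLeaves scopeLossRootCert = true := by
  decide

/-- **The scope-loss root is in-scope escapable**, this time by a one-row certificate plus CITED leaves.
[folklore] -/
theorem inScopeStateWins_scopeLossRoot' :
    InScopeStateWins 2
      (⟨[(![3, 1, 0, 0], 1), (![3, 0, 1, 1], 1)], ![0, 0, 0, 0], ∅⟩ : SData 4 (ZMod 2)).toState :=
  inScopeStateWins_head_of_iwinCertBL leaves_scopeLoss iwinCertBL_scopeLossRoot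

/-- Compatibility check by evaluation: with no leaves the landed five-row certificate still passes. [folklore] -/
theorem iwinCertBL_nil_scopeLoss : iwinCertBL 2 ([] : List (SData 4 (ZMod 2))) scopeLossCert = true := by
  rw [iwinCertBL_nil]; exact iwinCertB_scopeLoss

end InScopeWinCert

end Summit.ResolutionOfSingularities.ResolutionOfSingularities.Theorems.PIDim4

end
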